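import Summits.BirchSwinnertonDyer.Rank1Residual.F1Sign2.TamagawaExponentAtTwo
import HarnessLib

/-!
# ES-32 kernel — -es g23's glue `alMinimal_of_floor` (crux workfile `TamagawaExponentES32.lean` b7bd048e5c2107df l.221–233, VERBATIM) and REF1-AUDIT §235's BC7 certificates a–c
# (`REF1-data/b235/Probe235.lean` 04519f280d105f5b l.259–296 VERBATIM up to the namespace — `…Theorems.RankOneAtTwoTamagawaExponent.Kernel` for REF1's `….REF1_235`) + Probe235b's
# `oddPrimeCount 26 = 1` adapted to the tree decl, for `F1Sign2/TamagawaExponentAtTwo.lean` (typer -ty g20)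

CONTENT (all PROVED, no `sorry`, no new `def`): `alMinimal_of_floor` (-es: `SelmerAtkinLehnerFloorAtTwo` ⟹ `ALMinimalDegreeSelmerTrivialOnSlice`'s conclusion on an AL-minimal optimal
datum with `#W(ℚ)[2] = 1` — pure exponent arithmetic `#Sel₂·2^k ≤ 2·2^k`) · BC7-a (`decide`): `twoAdicFloorAtTwo` on `0..8` = `[0, 1, 0, 2, 2, 3, 3, 4, 4]` as documented (R235b: the dip at
`v = 2` is empirical) · BC7-b `slice_of_bound`: `WatkinsSelmerBoundAtTwo` ∧ `#W(ℚ)[2] = 1` ⟹ the slice inequality `#Sel₂(W) ≤ 2^{v₂ deg D}` (so `WatkinsSelmerBoundOnSlice`'s big-image /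
odd-torsion / Tamagawa / rank hypotheses only discharge «no rational 2-torsion») · BC7-c `bound_of_floor`: `SelmerAtkinLehnerFloorAtTwo` ∧ `#W(ℚ)[2] = 1` ∧ `1 ≤ ω_odd(N) + c(v₂N)` ⟹ the
same inequality (B♯ ⟹ B on curves without 2-torsion; the excluded case `N ∈ {1, 4}` has no curves) · `oddPrimeCount_twentySix`.  BSD is not proved by this; 23715 is not closed by this.
-/

open scoped Classical BigOperators AddSubgroup

noncomputable section

set_option linter.dupNamespace false
set_option autoImplicit false

namespace Summit.BirchSwinnertonDyer.BirchSwinnertonDyer.Theorems.RankOneAtTwoTamagawaExponent.Kernel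

open Literature.NumberTheory.EllipticCurves Literature.NumberTheory.EllipticCurves.ModularForms
  Summit.BirchSwinnertonDyer.Rank1Residual.F1Sign2
  Summit.BirchSwinnertonDyer.BirchSwinnertonDyer.Theorems.RankOneAtTwoOneDoor
  Summit.BirchSwinnertonDyer.BirchSwinnertonDyer.Theorems.RankOneAtTwoTamagawaExponent
  WeierstrassCurve

/-- (-es g23, crux workfile l.221–233, VERBATIM.) Elementary glue: the sharp floor implies the slice statement (pure arithmetic on the exponents: `#Sel₂ · 2^{k} ≤ 2 · 2^{k}`). -/
theorem alMinimal_of_floor (h : SelmerAtkinLehnerFloorAtTwo)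
    (W : WeierstrassCurve ℚ) [W.IsElliptic] [W.IsGloballyMinimal] [NeZero (W.conductorNorm ℤ)]
    (h2 : Nat.card (W.toAffine.Point[(2 : ℤ)]) = 1)
    (D : ModularParametrizationData W (W.conductorNorm ℤ))
    (hopt : ∀ (W'' : WeierstrassCurve ℚ) [W''.IsElliptic] (D'' : ModularParametrizationData W'' (W.conductorNorm ℤ)),
        D''.f = D.f → D.modularDegree ≤ D''.modularDegree)
    (hmin : padicValNat 2 D.modularDegree = oddPrimeCount (W.conductorNorm ℤ) + twoAdicFloorAtTwo (padicValNat 2 (W.conductorNorm ℤ))) :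
    Nat.card (W.selmerGroup 2) ≤ 2 := by
  have := h W D hopt h2
  rw [hmin] at this
  have hp : 0 < 2 ^ (oddPrimeCount (W.conductorNorm ℤ) + twoAdicFloorAtTwo (padicValNat 2 (W.conductorNorm ℤ))) := by positivity
  nlinarith

/-- BC7-a (the 2-adic floor step function has the documented values `c(0..8) = 0,1,0,2,2,3,3,4,4`; kernel). -/
example : (List.range 9).map twoAdicFloorAtTwo = [0, 1, 0, 2, 2, 3, 3, 4, 4] := by decide

/-- BC7-b (glue in the other direction: on a curve WITHOUT rational 2-torsion the plain Watkins–Selmer bound already gives the slice inequality —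
so `WatkinsSelmerBoundOnSlice`'s big-image/odd-torsion/Tamagawa/rank hypotheses are there only to discharge `#W(ℚ)[2] = 1`; kernel). -/
theorem slice_of_bound (h : WatkinsSelmerBoundAtTwo)
    (W : WeierstrassCurve ℚ) [W.IsElliptic] [W.IsGloballyMinimal] [NeZero (W.conductorNorm ℤ)]
    (D : ModularParametrizationData W (W.conductorNorm ℤ))
    (hopt : ∀ (W'' : WeierstrassCurve ℚ) [W''.IsElliptic] (D'' : ModularParametrizationData W'' (W.conductorNorm ℤ)),
        D''.f = D.f → D.modularDegree ≤ D''.modularDegree)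
    (h2 : Nat.card (W.toAffine.Point[(2 : ℤ)]) = 1) :
    Nat.card (W.selmerGroup 2) ≤ 2 ^ (padicValNat 2 D.modularDegree) := by
  have := h W D hopt
  rw [h2, mul_one] at this
  exact this

/-- BC7-c (the sharp floor implies the plain bound on curves without rational 2-torsion, since `ω_odd + c ≥ 0` … only when `ω_odd(N) + c(v₂N) ≥ 1`;
at `ω_odd = 0 ∧ c = 0` — conductor a power of 2 with `v₂(N) ∈ {0, 2}`, i.e. `N ∈ {1, 4}`, no curves — the sharp law is formally WEAKER by a factor 2.
Kernel form: floor + `1 ≤ ω_odd + c` ⟹ plain bound.) -/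
theorem bound_of_floor (h : SelmerAtkinLehnerFloorAtTwo)
    (W : WeierstrassCurve ℚ) [W.IsElliptic] [W.IsGloballyMinimal] [NeZero (W.conductorNorm ℤ)]
    (D : ModularParametrizationData W (W.conductorNorm ℤ))
    (hopt : ∀ (W'' : WeierstrassCurve ℚ) [W''.IsElliptic] (D'' : ModularParametrizationData W'' (W.conductorNorm ℤ)),
        D''.f = D.f → D.modularDegree ≤ D''.modularDegree)
    (h2 : Nat.card (W.toAffine.Point[(2 : ℤ)]) = 1)
    (hk : 1 ≤ oddPrimeCount (W.conductorNorm ℤ) + twoAdicFloorAtTwo (padicValNat 2 (W.conductorNorm ℤ))) :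
    Nat.card (W.selmerGroup 2) ≤ 2 ^ (padicValNat 2 D.modularDegree) := by
  have hf := h W D hopt h2
  set k := oddPrimeCount (W.conductorNorm ℤ) + twoAdicFloorAtTwo (padicValNat 2 (W.conductorNorm ℤ)) with hk'
  have h2k : (2 : ℕ) * 2 ^ (k - 1) = 2 ^ k := by
    obtain ⟨j, hj⟩ : ∃ j, k = j + 1 := ⟨k - 1, by omega⟩
    rw [hj, Nat.add_sub_cancel, pow_succ, mul_comm]
  have hpos : 0 < 2 ^ (k - 1) := by positivity
  -- #Sel · 2^k ≤ 2 · 2^v  and 2^k = 2 · 2^(k-1)  ⟹  #Sel · 2^(k-1) ≤ 2^v ⟹ #Sel ≤ 2^v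
  have : Nat.card (W.selmerGroup 2) * 2 ^ (k - 1) ≤ 2 ^ (padicValNat 2 D.modularDegree) := by
    have := hf; rw [← h2k] at this; nlinarith
  calc Nat.card (W.selmerGroup 2) ≤ Nat.card (W.selmerGroup 2) * 2 ^ (k - 1) := Nat.le_mul_of_pos_right _ hpos
    _ ≤ _ := this

/-- (REF1 Probe235b 62f2d102607cd909, adapted from its Mathlib-only primed copy to the tree decl.) `ω_odd(26) = 1`: the odd primes dividing `26 = 2·13` are `{13}`. -/
theorem oddPrimeCount_twentySix : oddPrimeCount 26 = 1 := by
  rw [oddPrimeCount, show (26 : ℕ) = 2 * 13 by norm_num, Nat.primeFactors_mul (by norm_num) (by norm_num),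
    Nat.Prime.primeFactors (by norm_num), Nat.Prime.primeFactors (by norm_num)]
  decide

end Summit.BirchSwinnertonDyer.BirchSwinnertonDyer.Theorems.RankOneAtTwoTamagawaExponent.Kernel

end
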